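import Literature.AlgebraicGeometry.ShimuraVarieties.CompactBallQuotientProjectiveEmbeddingProofs
import Literature.AlgebraicGeometry.ShimuraVarieties.UnitaryBallAutomorphicDescent
import HarnessLib

/-!
# An immersive projective system of Poincaré series on a compact ball quotient

Layer `Literature/AlgebraicGeometry/ShimuraVarieties`, grouping namespace `BallProjective`. For `Δ ≤ U(2,1)`
acting freely and properly discontinuously on `𝔹²` with compact quotient, Shafarevich's theorem
(`BallProjective.exists_projective_embedding`, *Basic Algebraic Geometry 2*, Ch. IX §3.2) gives a
holomorphic injective immersion `Δ\𝔹² → ℙᴺ(ℂ)` by automorphic forms of one weight — but its statement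
hides the forms. This file EXPOSES the system (the first step of that proof, immersivity only):

* `BallProjective.exists_immersive_system_finset` — a finite set `T` of holomorphic automorphic forms of
  one weight `k > 0` (`holFactorForms Δ (canonicalCocycle ℂ k)`), with no common zero, such that every
  point of `Δ\𝔹²` has a lift at which the system is immersive (kernel form: `df(z)u = μ f(z)` for all
  `f ∈ T` forces `u = 0`) — Shafarevich IX §3.2, proof of the Theorem ("raise the forms to a common
  weight"), from the Poincaré-series lemma (B) of the tree (`BallPoincare.exists_poincareSeries_immersion_subgroup`);
* `BallProjective.hasMFDerivAt_vecOfForms`, `mvfderiv_vecOfForms_apply` — the bridge between the manifold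
  differential of the vector-valued map `z ↦ (f(z))_{f}` (Hermitian model `EuclideanSpace ℂ (Fin (N + 1))`)
  and the derivatives of the zero extensions of its components;
* `BallProjective.exists_immersive_system` — the same system as ONE holomorphic map
  `G : 𝔹² → ℂᴺ⁺¹` (`N ≥ 1`), automorphic of weight `k` for the canonical cocycle, nowhere zero, immersive
  at a lift of every point: the input of the Fubini–Study / Kähler-datum construction
  (`UnitaryBallAutomorphicFubiniStudyForm`).

## References

* I. R. Shafarevich, *Basic Algebraic Geometry 2* (Springer 1994), Ch. IX §3.1 Proposition, §3.2 Theorem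
  and Lemma (B). [Shafarevich1994]
* P. Griffiths, J. Harris, *Principles of Algebraic Geometry* (1978), Ch. 1 §4. [GriffithsHarrisPrinciples1978]

## Provenance

pub-hodgecm2 cell (COR-CM), lane KAEHLER-HECKE-INV (b10); Step 1 of `exists_projective_embedding_of_separation`
(b06, LIT-FANOUT row D4) re-exposed. Theorems only; no definitions, no named facts.
-/

set_option autoImplicit false

noncomputable section

open scoped Manifold ContDiff Topology
open Set Filter MulAction Function
open Literature.Geometry.ComplexHyperbolic
open Literature.Geometry.ComplexHyperbolic.BallModel (U21 Ball nsq mat)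
open Literature.Geometry.Manifold
open Literature.NumberTheory.Automorphic.AutomorphyFactor

namespace Literature.AlgebraicGeometry.ShimuraVarieties

namespace BallProjective

open BallForms (holFactorForms canonicalCocycle canonicalFactor extend holomorphic ballSet
  canonicalFactor_ne_zero isOpen_ballSet)

variable (Δ : Subgroup U21) [ProperlyDiscontinuousSMul Δ Ball] [IsCancelSMul Δ Ball]

/-! ### Step 1 of Shafarevich's theorem: one immersive system of one weight -/

open scoped Classical in
/-- **An immersive finite system of automorphic forms of one weight** on a compact free ball quotient:
a finite set `T ⊂ holFactorForms Δ (canonicalCocycle ℂ k)`, `k > 0`, with no common zero, immersive at a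
lift of every point of `Δ\𝔹²` (Shafarevich IX §3.2, proof of the Theorem, first step: finitely many local
immersion systems by compactness, raised to a common weight).
[cite: Shafarevich1994, Ch. IX §3.2, Theorem and Lemma (B)] -/
theorem exists_immersive_system_finset [CompactSpace (orbitRel.Quotient Δ Ball)] :
    ∃ k, 0 < k ∧ ∃ T : Finset (Ball → ℂ), (∀ f ∈ T, f ∈ holFactorForms Δ (canonicalCocycle ℂ k)) ∧
      (∀ z : Ball, ∃ f ∈ T, f z ≠ 0) ∧
      ∀ q : orbitRel.Quotient Δ Ball, ∃ w : Ball, QuotientManifold.mk (G := Δ) w = q ∧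
        ∀ (u : Fin 2 → ℂ) (μ : ℂ), (∀ f ∈ T, fderiv ℂ (extend ℂ f) w.1 u = μ * f w) → u = 0 := by
  -- lattice sums of the properly discontinuous `Δ`
  have hS : ∀ n : ℕ, 6 ≤ n → Summable fun γ : Δ ↦ (‖mat (γ : U21) 2 2‖ ^ n)⁻¹ := fun _ hn ↦
    BallModel.summable_inv_norm_22_pow_of_cornerFinite_subgroup Δ
      (BallModel.finite_setOf_norm_22_subtype_le Δ) hn
  -- pointwise immersion systems in kernel form (Lemma (B) + the determinant criterion)
  have himm : ∀ z : Ball, ∃ k, 0 < k ∧ ∃ S : Finset (Ball → ℂ),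
      (∀ f ∈ S, f ∈ holFactorForms Δ (canonicalCocycle ℂ k)) ∧ (∃ f ∈ S, f z ≠ 0) ∧
        ∀ (u : Fin 2 → ℂ) (μ : ℂ), (∀ f ∈ S, fderiv ℂ (extend ℂ f) z.1 u = μ * f z) → u = 0 := by
    intro z
    obtain ⟨φ, hφh, hB, hB', k₀, hk₀⟩ := BallPoincare.exists_poincareSeries_immersion_subgroup Δ hS z
    obtain ⟨L, hL, -, hdet⟩ := hk₀ (max k₀ 2) (le_max_left _ _)
    set f : Fin 3 → Ball → ℂ := fun i z ↦
      ∑' γ : Δ, canonicalFactor (γ : U21) z ^ (max k₀ 2) * φ i ((γ : U21) • z) with hf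
    have hfmem : ∀ i, f i ∈ holFactorForms Δ (canonicalCocycle ℂ (max k₀ 2)) := by
      intro i
      obtain ⟨B, hBi⟩ := hB i
      obtain ⟨B', hBi'⟩ := hB' i
      exact BallPoincare.poincareSeries_mem_holFactorForms_of_latticeSum_subgroup Δ hS (le_max_right _ _)
        (hφh i) hBi hBi'
    have heq : (Matrix.of fun i : Fin 3 ↦ ![f i z, fderiv ℂ (extend ℂ (f i)) z.1 (Pi.single 0 1),
        fderiv ℂ (extend ℂ (f i)) z.1 (Pi.single 1 1)]) =
        Matrix.of fun i : Fin 3 ↦ ![f i z, L i (Pi.single 0 1), L i (Pi.single 1 1)] := by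
      ext i j
      simp only [Matrix.of_apply, (hL i).fderiv, hf]
    refine ⟨max k₀ 2, lt_of_lt_of_le two_pos (le_max_right _ _), Finset.univ.image f, fun g hg ↦ ?_,
      imm_of_det_ne_zero (by rw [heq]; exact hdet)⟩
    obtain ⟨i, -, rfl⟩ := Finset.mem_image.1 hg
    exact hfmem i
  -- Step 1 of Shafarevich's proof
  set mk : Ball → orbitRel.Quotient Δ Ball := QuotientManifold.mk (G := Δ) (M := Ball) with hmk_def
  have hmk_open : IsOpenMap mk := (BallModel.isLocalDiffeomorph_mk Δ).isOpenMap
  have hmk_eq : ∀ z w : Ball, mk z = mk w ↔ ∃ δ : Δ, δ • w = z := fun z w ↦ QuotientManifold.mk_eq_mk_iff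
  have hmk_out : ∀ q : orbitRel.Quotient Δ Ball, mk q.out = q := fun q ↦ Quotient.out_eq q
  choose kI hkI SI hSI hnzI himmI using himm
  have hO : ∀ z : Ball, IsOpen (mk '' {w : Ball | (∃ f ∈ SI z, f w ≠ 0) ∧ ∀ (u : Fin 2 → ℂ) (μ : ℂ),
      (∀ f ∈ SI z, fderiv ℂ (extend ℂ f) w.1 u = μ * f w) → u = 0}) := fun z ↦
    hmk_open _ (isOpen_setOf_imm fun f hf ↦ (BallForms.mem_holFactorForms_iff.1 (hSI z f hf)).2)
  obtain ⟨t₁, ht₁⟩ := isCompact_univ.elim_finite_subcover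
    (fun q : orbitRel.Quotient Δ Ball ↦ mk '' {w : Ball | (∃ f ∈ SI q.out, f w ≠ 0) ∧
      ∀ (u : Fin 2 → ℂ) (μ : ℂ), (∀ f ∈ SI q.out, fderiv ℂ (extend ℂ f) w.1 u = μ * f w) → u = 0})
    (fun q ↦ hO q.out)
    (fun q _ ↦ Set.mem_iUnion.2 ⟨q, ⟨q.out, ⟨hnzI q.out, himmI q.out⟩, hmk_out q⟩⟩)
  obtain ⟨K₁, hK₁, T₁, hT₁, hraise₁⟩ := exists_common_weight (Δ := Δ) t₁ (fun q ↦ kI q.out)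
    (fun q ↦ SI q.out) (fun q _ ↦ hkI q.out) (fun q _ ↦ hSI q.out)
  have himm₁ : ∀ q : orbitRel.Quotient Δ Ball, ∃ w : Ball, mk w = q ∧ (∃ f ∈ T₁, f w ≠ 0) ∧
      ∀ (u : Fin 2 → ℂ) (μ : ℂ), (∀ f ∈ T₁, fderiv ℂ (extend ℂ f) w.1 u = μ * f w) → u = 0 := by
    intro q
    obtain ⟨p, hp, hq⟩ := Set.mem_iUnion₂.1 (ht₁ (Set.mem_univ q))
    obtain ⟨w, hw, rfl⟩ := hq
    obtain ⟨j, hj⟩ := hraise₁ p hp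
    exact ⟨w, rfl, imm_mono_raise (fun f hf ↦ (BallForms.mem_holFactorForms_iff.1
      (hSI p.out f hf)).2) hj hw⟩
  have hnz₁ : ∀ z : Ball, ∃ f ∈ T₁, f z ≠ 0 := by
    intro z
    obtain ⟨w, hw, hnz, -⟩ := himm₁ (mk z)
    obtain ⟨δ, rfl⟩ := (hmk_eq w z).1 hw
    exact (exists_ne_zero_smul_iff hT₁ δ z).1 hnz
  exact ⟨K₁, hK₁, T₁, hT₁, hnz₁, fun q ↦
    let ⟨w, hw, _, h⟩ := himm₁ q
    ⟨w, hw, h⟩⟩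

/-! ### The vector-valued system and its manifold differential -/

variable {Δ}

variable {N : ℕ} (g : Fin (N + 1) → Ball → ℂ)

omit [ProperlyDiscontinuousSMul Δ Ball] [IsCancelSMul Δ Ball] in
/-- **The manifold differential of `z ↦ (g_i(z))_i`** at `z` is `u ↦ (dg_i(z) u)_i`, the derivatives of the
zero extensions of the components (the chart of `𝔹² ⊂ ℂ²` is the inclusion).
[cite: GriffithsHarrisPrinciples1978, Ch. 0 §2] -/
theorem hasMFDerivAt_vecOfForms (hg : ∀ i, g i ∈ holomorphic ℂ) (z : Ball) :
    HasMFDerivAt 𝓘(ℂ, Fin 2 → ℂ) 𝓘(ℂ, EuclideanSpace ℂ (Fin (N + 1)))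
      (fun z ↦ (EuclideanSpace.equiv (Fin (N + 1)) ℂ).symm (fun i ↦ g i z)) z
      (((EuclideanSpace.equiv (Fin (N + 1)) ℂ).symm : (Fin (N + 1) → ℂ) →L[ℂ] EuclideanSpace ℂ (Fin (N + 1))).comp
        (ContinuousLinearMap.pi fun i ↦ fderiv ℂ (extend ℂ (g i)) z.1)) := by
  have hcont : Continuous fun z ↦ (EuclideanSpace.equiv (Fin (N + 1)) ℂ).symm (fun i ↦ g i z) :=
    (EuclideanSpace.equiv (Fin (N + 1)) ℂ).symm.continuous.comp
      (continuous_pi fun i ↦ BallForms.continuous_of_mem_holomorphic (hg i))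
  refine ⟨hcont.continuousAt, ?_⟩
  have hev : writtenInExtChartAt 𝓘(ℂ, Fin 2 → ℂ) 𝓘(ℂ, EuclideanSpace ℂ (Fin (N + 1))) z
      (fun z ↦ (EuclideanSpace.equiv (Fin (N + 1)) ℂ).symm (fun i ↦ g i z)) =ᶠ[𝓝 z.1]
      fun w ↦ (EuclideanSpace.equiv (Fin (N + 1)) ℂ).symm (fun i ↦ extend ℂ (g i) w) := by
    filter_upwards [isOpen_ballSet.mem_nhds (BallForms.coe_mem_ballSet z)] with w hw
    have hw' : (extChartAt 𝓘(ℂ, Fin 2 → ℂ) z).symm w = ⟨w, hw⟩ := extChartAt_symm_apply_coe z ⟨w, hw⟩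
    simp only [writtenInExtChartAt, Function.comp_apply, hw', extChartAt_self_apply]
    change (EuclideanSpace.equiv (Fin (N + 1)) ℂ).symm (fun i ↦ g i ⟨w, hw⟩) = _
    congr 1
    funext i
    exact (BallForms.extend_apply_coe (g i) ⟨w, hw⟩).symm
  have hφd : HasFDerivAt (fun w ↦ (EuclideanSpace.equiv (Fin (N + 1)) ℂ).symm (fun i ↦ extend ℂ (g i) w))
      (((EuclideanSpace.equiv (Fin (N + 1)) ℂ).symm : (Fin (N + 1) → ℂ) →L[ℂ] EuclideanSpace ℂ (Fin (N + 1))).comp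
        (ContinuousLinearMap.pi fun i ↦ fderiv ℂ (extend ℂ (g i)) z.1)) z.1 :=
    ((EuclideanSpace.equiv (Fin (N + 1)) ℂ).symm : (Fin (N + 1) → ℂ) →L[ℂ] EuclideanSpace ℂ (Fin (N + 1))).hasFDerivAt.comp z.1
      (hasFDerivAt_pi.2 fun i ↦ (BallForms.differentiableAt_extend (hg i) z).hasFDerivAt)
  rw [modelWithCornersSelf_coe, Set.range_id]
  exact (hφd.congr_of_eventuallyEq hev).hasFDerivWithinAt

omit [ProperlyDiscontinuousSMul Δ Ball] [IsCancelSMul Δ Ball] in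
/-- Evaluation: `d((g_i)_i)_z u = (dg_i(z) u)_i`. [cite: GriffithsHarrisPrinciples1978, Ch. 0 §2] -/
theorem mvfderiv_vecOfForms_apply (hg : ∀ i, g i ∈ holomorphic ℂ) (z : Ball)
    (u : TangentSpace 𝓘(ℂ, Fin 2 → ℂ) z) :
    mvfderiv 𝓘(ℂ, Fin 2 → ℂ) (fun z ↦ (EuclideanSpace.equiv (Fin (N + 1)) ℂ).symm (fun i ↦ g i z)) z u =
      (EuclideanSpace.equiv (Fin (N + 1)) ℂ).symm (fun i ↦ fderiv ℂ (extend ℂ (g i)) z.1 u) := by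
  have h := (hasMFDerivAt_vecOfForms g hg z).mfderiv
  exact congrArg (fun L : TangentSpace 𝓘(ℂ, Fin 2 → ℂ) z →L[ℂ] TangentSpace 𝓘(ℂ, EuclideanSpace ℂ (Fin (N + 1)))
    ((EuclideanSpace.equiv (Fin (N + 1)) ℂ).symm (fun i ↦ g i z)) ↦ (show EuclideanSpace ℂ (Fin (N + 1)) from L u)) h

omit [ProperlyDiscontinuousSMul Δ Ball] [IsCancelSMul Δ Ball] in
/-- `z ↦ (g_i(z))_i` is holomorphic on the manifold `𝔹²`. [cite: Shafarevich1994, Ch. VIII §1.1] -/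
theorem mdifferentiable_vecOfForms (hg : ∀ i, g i ∈ holomorphic ℂ) :
    MDifferentiable 𝓘(ℂ, Fin 2 → ℂ) 𝓘(ℂ, EuclideanSpace ℂ (Fin (N + 1)))
      (fun z ↦ (EuclideanSpace.equiv (Fin (N + 1)) ℂ).symm (fun i ↦ g i z)) := fun z ↦
  (hasMFDerivAt_vecOfForms g hg z).mdifferentiableAt

omit [ProperlyDiscontinuousSMul Δ Ball] [IsCancelSMul Δ Ball] in
/-- A family of forms of weight `k` gives a vector-valued form of weight `k`. [cite: Shafarevich1994, Ch. IX §3.1] -/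
theorem vecOfForms_mem_factorForms {k : ℕ} (hg : ∀ i, g i ∈ holFactorForms Δ (canonicalCocycle ℂ k)) :
    (fun z ↦ (EuclideanSpace.equiv (Fin (N + 1)) ℂ).symm (fun i ↦ g i z)) ∈
      factorForms Δ (canonicalCocycle (EuclideanSpace ℂ (Fin (N + 1))) k) := by
  intro γ hγ z
  rw [BallForms.canonicalCocycle_apply, ← map_smul]
  change (EuclideanSpace.equiv (Fin (N + 1)) ℂ).symm (fun i ↦ g i z) = _
  congr 1
  funext i
  have h := (mem_factorForms_iff.1 (BallForms.mem_holFactorForms_iff.1 (hg i)).1) γ hγ z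
  rw [BallForms.canonicalCocycle_apply] at h
  rw [Pi.smul_apply]
  exact h

/-! ### The exposed system as one vector-valued map -/

variable (Δ)

/-- **An immersive projective system of automorphic forms on a compact free ball quotient**: `N ≥ 1`, a
weight `k > 0` and a holomorphic `G : 𝔹² → ℂᴺ⁺¹`, automorphic of weight `k` for the canonical cocycle,
nowhere zero, such that every point of `Δ\𝔹²` has a lift `z` at which `dG_z u ∈ ℂ · G(z)` forces `u = 0`
(Shafarevich IX §3.2: the forms of Step 1 of the proof of the Theorem, padded by a repeated coordinate so
that `N ≥ 1`). [cite: Shafarevich1994, Ch. IX §3.2, Theorem and Lemma (B)] -/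
theorem exists_immersive_system [CompactSpace (orbitRel.Quotient Δ Ball)] :
    ∃ (N k : ℕ) (G : Ball → EuclideanSpace ℂ (Fin (N + 1))), 1 ≤ N ∧ 0 < k ∧
      MDifferentiable 𝓘(ℂ, Fin 2 → ℂ) 𝓘(ℂ, EuclideanSpace ℂ (Fin (N + 1))) G ∧ G ∈ factorForms Δ (canonicalCocycle (EuclideanSpace ℂ (Fin (N + 1))) k) ∧
      (∀ z, G z ≠ 0) ∧
      ∀ q : orbitRel.Quotient Δ Ball, ∃ z : Ball, QuotientManifold.mk (G := Δ) z = q ∧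
        ∀ (u : TangentSpace 𝓘(ℂ, Fin 2 → ℂ) z) (r : ℂ), mvfderiv 𝓘(ℂ, Fin 2 → ℂ) G z u = r • G z → u = 0 := by
  obtain ⟨k, hk, T, hT, hnz, himm⟩ := exists_immersive_system_finset Δ
  -- a distinguished form and an enumeration of `T`
  obtain ⟨f₀, hf₀, -⟩ := hnz ⟨0, by simp [nsq]⟩
  set N := T.card with hN
  set e : Fin N ≃ ↥T := T.equivFin.symm with he
  set g : Fin (N + 1) → Ball → ℂ := Fin.lastCases f₀ (fun j ↦ ((e j : ↥T) : Ball → ℂ)) with hgdef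
  have hgmem : ∀ i, g i ∈ T := by
    intro i
    refine Fin.lastCases ?_ (fun j ↦ ?_) i
    · simpa [hgdef] using hf₀
    · simp [hgdef, Fin.lastCases_castSucc]
  have hsurj : ∀ f ∈ T, ∃ i, g i = f := fun f hf ↦
    ⟨Fin.castSucc (e.symm ⟨f, hf⟩), by simp [hgdef, Fin.lastCases_castSucc, he]⟩
  have hghol : ∀ i, g i ∈ holomorphic ℂ := fun i ↦ (BallForms.mem_holFactorForms_iff.1 (hT _ (hgmem i))).2
  have hN1 : 1 ≤ N := Finset.card_pos.2 ⟨f₀, hf₀⟩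
  refine ⟨N, k, fun z ↦ (EuclideanSpace.equiv (Fin (N + 1)) ℂ).symm (fun i ↦ g i z), hN1, hk,
    mdifferentiable_vecOfForms g hghol, vecOfForms_mem_factorForms g (fun i ↦ hT _ (hgmem i)),
    fun z h0 ↦ ?_, fun q ↦ ?_⟩
  · -- nowhere zero
    obtain ⟨f, hf, hfz⟩ := hnz z
    obtain ⟨i, rfl⟩ := hsurj f hf
    apply hfz
    have h := congrArg (fun v : EuclideanSpace ℂ (Fin (N + 1)) ↦ v i) h0
    simpa using h
  · -- immersive at a lift
    obtain ⟨w, hw, himmw⟩ := himm q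
    refine ⟨w, hw, fun u r hu ↦ himmw u r fun f hf ↦ ?_⟩
    obtain ⟨i, rfl⟩ := hsurj f hf
    rw [mvfderiv_vecOfForms_apply g hghol w u, ← map_smul] at hu
    have h := congrArg (fun v : EuclideanSpace ℂ (Fin (N + 1)) ↦ v i) hu
    simpa using h

end BallProjective

end Literature.AlgebraicGeometry.ShimuraVarieties

end
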